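import Summits.QuantumFields.QCD.Theorems.SmallFieldUltracontractivity.Negative.Tightness
import Literature.Probability.LatticeModels.TorusFourierProofs

/-!
# Stub `stub_gaugeTransfer` of line `point-centred-axial-parabolic`
(crux `Summit.QuantumFields.QCD.Theses.HeatSlicedQuarks.SmallFieldUltracontractivity`, item stmt-QuantumFields-8871)

The TRANSFER step of the line: the registered stub signature (tree vocabulary only; `SU3` is the
abbreviation of `Theorems/SmallFieldUltracontractivity/Negative/LoadBearing.lean`) is the chain of
implications "CombGauge → GaugeCovariance → DiagonalMonotone → LocalSupBound → DiagonalKernelBound".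
The proof is scale arithmetic only: with `K := 1`, `ε := κ / max C_A 1`, `C := 64⁴ + 196608 C₃²`,
small times/scales are handled by `kernelEntry_le_one`, and otherwise the comb gauge on a cube of
radius `2ℓ + 1` (`ℓ = ⌈√(t'/2)⌉₊ ≤ r/8`, `t' = min t (r²/128)`) feeds the local sup bound, which is
turned into the diagonal bound by the T*T identity `exp_neg_smul_apply_self_eq_sum_norm_sq`, gauge
covariance of the colour-summed diagonal and monotonicity in the time. [folklore]
-/

noncomputable section

namespace Summit.QuantumFields.QCD.Cruxes.SmallFieldUltracontractivity.PointCentredAxialParabolic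

open Literature.MathematicalPhysics.QuantumLattice Literature.MathematicalPhysics.QuantumFieldTheory
open Literature.Probability.LatticeModels (TorusSite torusChar)
open Summit.QuantumFields.QCD.Theorems.SmallFieldUltracontractivity.Negative
open scoped Matrix ComplexConjugate

/-- **Transfer (stub `stub_gaugeTransfer`).**  From the comb gauge (`hComb`), gauge covariance of the
colour-summed diagonal heat kernel and of plaquette traces (`hCov`), monotonicity of the diagonal in the
time (`hMono`) and the gauge-fixed local `ℓ² → ℓ^∞` bound (`hLocal`, constants `κ > 0`, `C₃`) to the
diagonal kernel bound of the crux, with `ε := κ / max C_A 1`, `K := 1`, `C := 64⁴ + 196608 C₃²`.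
For `t < 64` or `r < 64` the entry is `≤ 1 ≤ 64⁴/t²` (`kernelEntry_le_one`); otherwise with
`t' := min t (r²/128) ∈ [t/128, t]`, `s := t'/2`, `ℓ := ⌈√s⌉₊ ≤ r/8`, the comb gauge on the cube of
radius `2ℓ + 1` produces `W = g • U` whose links are `(κ/ℓ)`-flat and plaquettes `(κ/ℓ²)`-flat on the
`2ℓ`-ball, so `hLocal` and the T*T identity give `Re e^{-t'H_W}((x,b,α),(x,b,α)) ≤ (C₃/s)²` for every
colour `b`; summing over colours (all diagonal real parts are `≥ 0`), gauge covariance and monotonicity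
give `Re e^{-tH_U}((x,a,α),(x,a,α)) ≤ 12 C₃²/t'² ≤ 196608 C₃²/t²`. -/
theorem stub_gaugeTransfer :
    (∃ C_A : ℝ, ∀ (L : ℕ) [NeZero L] (U : GaugeConfig 4 L SU3) (x : TorusSite 4 L) (R : ℕ),
      2 * R + 1 ≤ L → ∀ δ : ℝ, 0 ≤ δ →
      (∀ y : TorusSite 4 L, torusDist x y ≤ R → ∀ μ ν : Fin 4,
        3 - ((fundamentalRep (Fin 3)) (plaquetteHolonomy U y μ ν)).trace.re ≤ δ ^ 2) →
      ∃ g : TorusSite 4 L → SU3, ∀ z : TorusSite 4 L, torusDist x z + 1 ≤ R → ∀ μ : Fin 4,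
        3 - ((fundamentalRep (Fin 3)) (gaugeTransform g U (z, μ))).trace.re
          ≤ C_A * ((torusDist x z : ℝ) + 1) ^ 2 * δ ^ 2) →
    (∀ (L : ℕ) [NeZero L] (U : GaugeConfig 4 L SU3) (g : TorusSite 4 L → SU3) (m t : ℝ)
      (x : TorusSite 4 L),
      (∀ α : Fin 4,
        ∑ a : Fin 3, (NormedSpace.exp (-(t : ℂ) •
            ((wilsonDirac (fundamentalRep (Fin 3)) (gaugeTransform g U) m 1)ᴴ *
              wilsonDirac (fundamentalRep (Fin 3)) (gaugeTransform g U) m 1))) (x, a, α) (x, a, α) =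
        ∑ a : Fin 3, (NormedSpace.exp (-(t : ℂ) •
            ((wilsonDirac (fundamentalRep (Fin 3)) U m 1)ᴴ *
              wilsonDirac (fundamentalRep (Fin 3)) U m 1))) (x, a, α) (x, a, α)) ∧
      ∀ μ ν : Fin 4, ((fundamentalRep (Fin 3)) (plaquetteHolonomy (gaugeTransform g U) x μ ν)).trace =
        ((fundamentalRep (Fin 3)) (plaquetteHolonomy U x μ ν)).trace) →
    (∀ (ι : Type) [Fintype ι] [DecidableEq ι] (A : Matrix ι ι ℂ) (i : ι) (t' t : ℝ), 0 ≤ t' → t' ≤ t →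
      ((NormedSpace.exp (-(t : ℂ) • (Aᴴ * A))) i i).re ≤ ((NormedSpace.exp (-(t' : ℂ) • (Aᴴ * A))) i i).re) →
    (∃ κ : ℝ, 0 < κ ∧ ∃ C : ℝ, ∀ (L : ℕ) [NeZero L] (U : GaugeConfig 4 L SU3) (m : ℝ),
      m ∈ Set.Icc (-(1 / 2 : ℝ)) 1 → ∀ (x : TorusSite 4 L) (ℓ : ℕ), 1 ≤ ℓ → 4 * ℓ < L →
      (∀ z : TorusSite 4 L, torusDist x z ≤ 2 * ℓ →
        (∀ μ : Fin 4, 3 - ((fundamentalRep (Fin 3)) (U (z, μ))).trace.re ≤ (κ / (ℓ : ℝ)) ^ 2) ∧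
        (∀ μ ν : Fin 4, 3 - ((fundamentalRep (Fin 3)) (plaquetteHolonomy U z μ ν)).trace.re
          ≤ (κ / (ℓ : ℝ) ^ 2) ^ 2)) →
      ∀ s : ℝ, 1 ≤ s → s ≤ (ℓ : ℝ) ^ 2 → ∀ (a : Fin 3) (α : Fin 4),
        ∑ j, ‖(NormedSpace.exp (-(s : ℂ) •
            ((wilsonDirac (fundamentalRep (Fin 3)) U m 1)ᴴ * wilsonDirac (fundamentalRep (Fin 3)) U m 1)))
          (x, a, α) j‖ ^ 2 ≤ (C / s) ^ 2) →
    (∃ ε : ℝ, 0 < ε ∧ ∃ K : ℕ, ∃ C : ℝ, ∀ (L : ℕ) [NeZero L] (U : GaugeConfig 4 L SU3) (m : ℝ),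
      m ∈ Set.Icc (-(1 / 2 : ℝ)) 1 → ∀ (x : TorusSite 4 L) (r : ℕ), 1 ≤ r → r ≤ L →
      (∀ y : TorusSite 4 L, torusDist x y ≤ K * r → ∀ μ ν : Fin 4,
        3 - ((fundamentalRep (Fin 3)) (plaquetteHolonomy U y μ ν)).trace.re ≤ (ε / (r : ℝ) ^ 2) ^ 2) →
      ∀ t : ℝ, 1 ≤ t → t ≤ (r : ℝ) ^ 2 → ∀ (a : Fin 3) (α : Fin 4),
        ((NormedSpace.exp (-(t : ℂ) •
            ((wilsonDirac (fundamentalRep (Fin 3)) U m 1)ᴴ * wilsonDirac (fundamentalRep (Fin 3)) U m 1)))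
          (x, a, α) (x, a, α)).re ≤ C / t ^ 2) := by
  intro hComb hCov hMono hLocal
  obtain ⟨C_A, hComb⟩ := hComb
  obtain ⟨κ, hκ, C₃, hLocal⟩ := hLocal
  -- constants: `A := max C_A 1`, `ε := κ / A`, `K := 1`, `C := 64⁴ + 196608 C₃²`
  have hA1 : (1 : ℝ) ≤ max C_A 1 := le_max_right _ _
  have hA0 : (0 : ℝ) < max C_A 1 := one_pos.trans_le hA1
  have hCA : C_A ≤ max C_A 1 := le_max_left _ _
  refine ⟨κ / max C_A 1, div_pos hκ hA0, 1, 64 ^ 4 + 196608 * C₃ ^ 2, ?_⟩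
  intro L _ U m hm x r hr hrL hflat t ht htr a α
  have ht0 : (0 : ℝ) < t := one_pos.trans_le ht
  have hC₃ : (0 : ℝ) ≤ 196608 * C₃ ^ 2 := by positivity
  -- every diagonal entry has real part `≤ 1`
  have hre1 : ((NormedSpace.exp (-(t : ℂ) • ((wilsonDirac (fundamentalRep (Fin 3)) U m 1)ᴴ *
      wilsonDirac (fundamentalRep (Fin 3)) U m 1))) (x, a, α) (x, a, α)).re ≤ 1 :=
    ((le_abs_self _).trans (Complex.abs_re_le_norm _)).trans (kernelEntry_le_one U m ht0.le x a a α α)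
  by_cases hsmall : t < 64 ∨ r < 64
  · -- (i) small `t` or small `r`: `Re ≤ 1 ≤ 64⁴ / t²`
    have ht2 : t ^ 2 ≤ (64 : ℝ) ^ 4 := by
      rcases hsmall with h | h
      · nlinarith
      · have hr63 : (r : ℝ) ≤ 63 := by exact_mod_cast Nat.lt_succ_iff.mp h
        have hr0 : (0 : ℝ) ≤ r := Nat.cast_nonneg r
        have h63 : t ≤ 63 ^ 2 := htr.trans (by nlinarith)
        nlinarith
    rw [le_div_iff₀ (by positivity)]
    calc _ ≤ (1 : ℝ) * 64 ^ 4 := mul_le_mul hre1 ht2 (by positivity) zero_le_one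
      _ ≤ _ := by linarith
  -- (ii) `64 ≤ t`, `64 ≤ r`: the intermediate time `t' = min t (r² / 128)`
  push Not at hsmall
  obtain ⟨ht64, hr64⟩ := hsmall
  have hr64' : (64 : ℝ) ≤ r := by exact_mod_cast hr64
  have hr0 : (0 : ℝ) < r := by linarith
  obtain ⟨t', ht't, ht'r, ht'32, htt'⟩ :
      ∃ t' : ℝ, t' ≤ t ∧ t' ≤ (r : ℝ) ^ 2 / 128 ∧ 32 ≤ t' ∧ t ≤ 128 * t' := by
    refine ⟨min t ((r : ℝ) ^ 2 / 128), min_le_left _ _, min_le_right _ _,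
      le_min (by linarith) (by nlinarith), ?_⟩
    rcases le_total t ((r : ℝ) ^ 2 / 128) with h | h
    · rw [min_eq_left h]; linarith
    · rw [min_eq_right h]; linarith
  have ht'0 : (0 : ℝ) < t' := by linarith
  -- (iii) the working scale `ℓ = ⌈√(t'/2)⌉₊`
  obtain ⟨ℓ, hℓ1, hsℓ, h8ℓ⟩ : ∃ ℓ : ℕ, 1 ≤ ℓ ∧ t' / 2 ≤ (ℓ : ℝ) ^ 2 ∧ 8 * ℓ ≤ r := by
    refine ⟨⌈Real.sqrt (t' / 2)⌉₊, ?_, ?_, ?_⟩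
    · exact Nat.lt_ceil.mpr (by rw [Nat.cast_zero]; exact Real.sqrt_pos.mpr (by linarith))
    · calc t' / 2 = Real.sqrt (t' / 2) ^ 2 := (Real.sq_sqrt (by linarith)).symm
        _ ≤ _ := by gcongr; exact Nat.le_ceil _
    · have h1 : (⌈Real.sqrt (t' / 2)⌉₊ : ℝ) < Real.sqrt (t' / 2) + 1 :=
        Nat.ceil_lt_add_one (Real.sqrt_nonneg _)
      have h2 : Real.sqrt (t' / 2) ≤ r / 16 := by
        rw [show (r : ℝ) / 16 = Real.sqrt (((r : ℝ) / 16) ^ 2) from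
          (Real.sqrt_sq (by positivity)).symm]
        exact Real.sqrt_le_sqrt (by nlinarith)
      have h3 : ((8 * ⌈Real.sqrt (t' / 2)⌉₊ : ℕ) : ℝ) ≤ r := by push_cast; linarith
      exact_mod_cast h3
  have hℓ0 : (0 : ℝ) < ℓ := by exact_mod_cast hℓ1
  have hℓ1' : (1 : ℝ) ≤ ℓ := by exact_mod_cast hℓ1
  have h8ℓ' : 8 * (ℓ : ℝ) ≤ r := by exact_mod_cast h8ℓ
  have hs1 : (1 : ℝ) ≤ t' / 2 := by linarith
  have h4ℓ : 4 * ℓ < L := by omega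
  -- (iv) the comb gauge on the (non-wrapping) cube of radius `R = 2ℓ + 1 ≤ r`
  obtain ⟨g, hg⟩ := hComb L U x (2 * ℓ + 1) (by omega) (κ / max C_A 1 / (r : ℝ) ^ 2)
    (by positivity) (fun y hy μ ν => hflat y (by omega) μ ν)
  have hgeom : (2 * (ℓ : ℝ) + 1) ^ 2 * (ℓ : ℝ) ^ 2 ≤ (r : ℝ) ^ 4 := by
    calc (2 * (ℓ : ℝ) + 1) ^ 2 * (ℓ : ℝ) ^ 2 ≤ (3 * (ℓ : ℝ)) ^ 2 * (ℓ : ℝ) ^ 2 := by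
          gcongr; linarith
      _ ≤ (8 * (ℓ : ℝ)) ^ 4 := by nlinarith [sq_nonneg ((ℓ : ℝ) ^ 2)]
      _ ≤ (r : ℝ) ^ 4 := by gcongr
  have hℓr : (ℓ : ℝ) ^ 2 ≤ max C_A 1 * (r : ℝ) ^ 2 := by
    have : (ℓ : ℝ) ≤ r := by linarith
    calc (ℓ : ℝ) ^ 2 ≤ (r : ℝ) ^ 2 := by gcongr
      _ = 1 * (r : ℝ) ^ 2 := (one_mul _).symm
      _ ≤ max C_A 1 * (r : ℝ) ^ 2 := by gcongr
  -- smallness of the gauged field `W := g • U` on the ball of radius `2ℓ` around `x`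
  have hWsmall : ∀ z : TorusSite 4 L, torusDist x z ≤ 2 * ℓ →
      (∀ μ : Fin 4, 3 - ((fundamentalRep (Fin 3)) (gaugeTransform g U (z, μ))).trace.re ≤
        (κ / (ℓ : ℝ)) ^ 2) ∧
      (∀ μ ν : Fin 4,
        3 - ((fundamentalRep (Fin 3)) (plaquetteHolonomy (gaugeTransform g U) z μ ν)).trace.re ≤
          (κ / (ℓ : ℝ) ^ 2) ^ 2) := by
    intro z hz
    refine ⟨fun μ => ?_, fun μ ν => ?_⟩
    · have hz1 : torusDist x z + 1 ≤ 2 * ℓ + 1 := by omega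
      have hd : (torusDist x z : ℝ) + 1 ≤ 2 * ℓ + 1 := by exact_mod_cast hz1
      have hd0 : (0 : ℝ) ≤ (torusDist x z : ℝ) + 1 := by positivity
      refine (hg z hz1 μ).trans ?_
      have h1 : C_A * ((torusDist x z : ℝ) + 1) ^ 2 ≤ max C_A 1 * (2 * (ℓ : ℝ) + 1) ^ 2 :=
        mul_le_mul hCA (pow_le_pow_left₀ hd0 hd 2) (by positivity) hA0.le
      calc C_A * ((torusDist x z : ℝ) + 1) ^ 2 * (κ / max C_A 1 / (r : ℝ) ^ 2) ^ 2
          ≤ max C_A 1 * (2 * (ℓ : ℝ) + 1) ^ 2 * (κ / max C_A 1 / (r : ℝ) ^ 2) ^ 2 :=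
            mul_le_mul_of_nonneg_right h1 (sq_nonneg _)
        _ = (2 * (ℓ : ℝ) + 1) ^ 2 * κ ^ 2 / (max C_A 1 * (r : ℝ) ^ 4) := by
            field_simp
        _ ≤ (κ / (ℓ : ℝ)) ^ 2 := by
            rw [div_pow, div_le_div_iff₀ (by positivity) (by positivity)]
            nlinarith [mul_le_mul_of_nonneg_left hgeom (sq_nonneg κ),
              mul_le_mul_of_nonneg_left hA1 (by positivity : (0 : ℝ) ≤ κ ^ 2 * (r : ℝ) ^ 4)]
    · have hz' : torusDist x z ≤ 1 * r := by omega
      rw [(hCov L U g m t z).2 μ ν]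
      refine (hflat z hz' μ ν).trans ?_
      apply pow_le_pow_left₀ (by positivity)
      rw [div_div]
      exact div_le_div_of_nonneg_left hκ.le (by positivity) hℓr
  -- (v)/(vi) the kernel estimate
  set D := wilsonDirac (fundamentalRep (Fin 3)) U m 1 with hD
  set DW := wilsonDirac (fundamentalRep (Fin 3)) (gaugeTransform g U) m 1 with hDW
  -- T*T: diagonal entries at time `t'` are the (real, nonnegative) squared row norms at time `t'/2`
  have hdiag_re : ∀ (B : Matrix (TorusSite 4 L × Fin 3 × Fin 4) (TorusSite 4 L × Fin 3 × Fin 4) ℂ)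
      (i : TorusSite 4 L × Fin 3 × Fin 4),
      ((NormedSpace.exp (-(t' : ℂ) • (Bᴴ * B))) i i).re =
        ∑ j, ‖(NormedSpace.exp (-((t' / 2 : ℝ) : ℂ) • (Bᴴ * B))) i j‖ ^ 2 := by
    intro B i
    rw [exp_neg_smul_apply_self_eq_sum_norm_sq B t' i, ← Complex.ofReal_sum, Complex.ofReal_re]
  have hnonneg : ∀ b : Fin 3, 0 ≤ ((NormedSpace.exp (-(t' : ℂ) • (Dᴴ * D))) (x, b, α) (x, b, α)).re := by
    intro b
    rw [hdiag_re]
    positivity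
  have hWb : ∀ b : Fin 3,
      ((NormedSpace.exp (-(t' : ℂ) • (DWᴴ * DW))) (x, b, α) (x, b, α)).re ≤ (C₃ / (t' / 2)) ^ 2 := by
    intro b
    rw [hdiag_re]
    exact hLocal L (gaugeTransform g U) m hm x ℓ hℓ1 h4ℓ hWsmall (t' / 2) hs1 hsℓ b α
  have hsum : ∑ b : Fin 3, ((NormedSpace.exp (-(t' : ℂ) • (Dᴴ * D))) (x, b, α) (x, b, α)).re =
      ∑ b : Fin 3, ((NormedSpace.exp (-(t' : ℂ) • (DWᴴ * DW))) (x, b, α) (x, b, α)).re := by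
    have h := congrArg Complex.re ((hCov L U g m t' x).1 α)
    rw [Complex.re_sum, Complex.re_sum] at h
    exact h.symm
  have hmono := hMono (TorusSite 4 L × Fin 3 × Fin 4) D (x, a, α) t' t ht'0.le ht't
  calc ((NormedSpace.exp (-(t : ℂ) • (Dᴴ * D))) (x, a, α) (x, a, α)).re
      ≤ ((NormedSpace.exp (-(t' : ℂ) • (Dᴴ * D))) (x, a, α) (x, a, α)).re := hmono
    _ ≤ ∑ b : Fin 3, ((NormedSpace.exp (-(t' : ℂ) • (Dᴴ * D))) (x, b, α) (x, b, α)).re :=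
        Finset.single_le_sum
          (f := fun b => ((NormedSpace.exp (-(t' : ℂ) • (Dᴴ * D))) (x, b, α) (x, b, α)).re)
          (fun b _ => hnonneg b) (Finset.mem_univ a)
    _ = ∑ b : Fin 3, ((NormedSpace.exp (-(t' : ℂ) • (DWᴴ * DW))) (x, b, α) (x, b, α)).re := hsum
    _ ≤ ∑ _b : Fin 3, (C₃ / (t' / 2)) ^ 2 := Finset.sum_le_sum fun b _ => hWb b
    _ = 12 * C₃ ^ 2 / t' ^ 2 := by
        rw [Finset.sum_const, Finset.card_univ, Fintype.card_fin, nsmul_eq_mul]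
        field_simp
        ring
    _ ≤ (64 ^ 4 + 196608 * C₃ ^ 2) / t ^ 2 := by
        rw [div_le_div_iff₀ (by positivity) (by positivity)]
        have htsq : t ^ 2 ≤ (128 * t') ^ 2 := by gcongr
        nlinarith [mul_le_mul_of_nonneg_left htsq (by positivity : (0 : ℝ) ≤ 12 * C₃ ^ 2),
          (by positivity : (0 : ℝ) ≤ 64 ^ 4 * t' ^ 2)]

end Summit.QuantumFields.QCD.Cruxes.SmallFieldUltracontractivity.PointCentredAxialParabolic

end
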